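import Summits.Ventures.Crystal3D.StickySpheres.ExtensionStep
import HarnessLib

/-!
# Kernel-checkable cone certificates: Boolean adjacency tables, the cone table, and the degree-count lookup

Venture `Crystal3D` (cell `pub-crystal3d`, seat p3). Infrastructure that lets the extension step of `ExtensionStep.lean`
be DISCHARGED BY COMPUTATION (`decide`, kernel only — no `native_decide`) for explicit listed graphs:

* `boolGraph adj` — the graph on `Fin k` of a symmetric irreflexive Boolean table, with
  `degree_boolGraph : degree v = (List.finRange k).countP (adj v)` and `card_filter_univ_eq_countP`;
* `coneAdjB adj s` — the Boolean table of the cone `coneGraph (Fin.last k) (boolGraph adj) {i | s i}` and the equation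
  `coneGraph_boolGraph` identifying the two;
* `degree_congr_of_eq`, `card_edgeFinset_congr_of_eq` — instance-independent transport along a graph equality;
* **the degree-count lookup** `card_adjDegree_eq_of_iso`: if all degrees of `G` are `≥ d > 0`, `deg w = d`, and
  `G − w ≅ H`, then the number of degree-`d` neighbours of `w` equals the number of degree-`(d − 1)` vertices of `H`
  (so a mismatch refutes `G − w ≅ H` without any isomorphism search);
* `testBit_sum_two_pow_val` / `sum_two_pow_val_mem_range` — a subset `S ⊆ Fin k` as the bitmask `∑_{i ∈ S} 2^i < 2^k`, so
  that "for all `S`" becomes "for all `c < 2^k`".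

HONEST FRAMING: [folklore] bookkeeping; no statement about packings. Used by `TwelveVertexCones.lean`.
-/

namespace Summit.Ventures.Crystal3D

open Finset SimpleGraph

/-! ### 1. Graphs from Boolean tables -/

section Bool

variable {k : ℕ}

/-- The graph on `Fin k` with adjacency read off a symmetric, irreflexive Boolean table. [folklore] -/
def boolGraph (adj : Fin k → Fin k → Bool) (hs : ∀ a b, adj a b = adj b a) (hl : ∀ a, adj a a = false) :
    SimpleGraph (Fin k) where
  Adj a b := adj a b = true
  symm := ⟨fun a b h => by rw [hs]; exact h⟩
  loopless := ⟨fun a h => by rw [hl] at h; exact Bool.false_ne_true h⟩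

/-- Decidability of adjacency in `boolGraph` (by table lookup). -/
instance boolGraph.decidableRel (adj : Fin k → Fin k → Bool) (hs : ∀ a b, adj a b = adj b a)
    (hl : ∀ a, adj a a = false) : DecidableRel (boolGraph adj hs hl).Adj := fun a b =>
  inferInstanceAs (Decidable (adj a b = true))

/-- Adjacency in `boolGraph`, unfolded. [folklore] -/
@[simp] theorem boolGraph_adj (adj : Fin k → Fin k → Bool) (hs : ∀ a b, adj a b = adj b a) (hl : ∀ a, adj a a = false)
    (a b : Fin k) : (boolGraph adj hs hl).Adj a b ↔ adj a b = true := Iff.rfl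

/-- Adjacency of `boolGraph` as a Boolean. [folklore] -/
@[simp] theorem decide_boolGraph_adj (adj : Fin k → Fin k → Bool) (hs : ∀ a b, adj a b = adj b a)
    (hl : ∀ a, adj a a = false) (a b : Fin k) : decide ((boolGraph adj hs hl).Adj a b) = adj a b :=
  Bool.decide_eq_true

/-- A filtered count over `Fin k` is a `countP` over `List.finRange k` (the form the kernel evaluates). [folklore] -/
theorem card_filter_univ_eq_countP (p : Fin k → Prop) [DecidablePred p] :
    (Finset.univ.filter p).card = (List.finRange k).countP fun i => decide (p i) := by
  rw [Finset.card_def, Finset.filter_val, Finset.val_univ_fin, Multiset.filter_coe, Multiset.coe_card,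
    List.countP_eq_length_filter]

/-- **Degrees of a table graph are counts:** `deg v = #{u | adj v u}`. [folklore] -/
theorem degree_boolGraph (adj : Fin k → Fin k → Bool) (hs : ∀ a b, adj a b = adj b a) (hl : ∀ a, adj a a = false)
    (v : Fin k) : (boolGraph adj hs hl).degree v = (List.finRange k).countP fun u => adj v u := by
  rw [← card_neighborFinset_eq_degree, neighborFinset_eq_filter, card_filter_univ_eq_countP]
  simp only [boolGraph_adj, Bool.decide_eq_true]

/-! ### 2. The cone table -/

/-- Boolean table of the cone over `adj` with the new vertex LAST, joined to `{i | s i}`. [folklore] -/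
def coneAdjB (adj : Fin k → Fin k → Bool) (s : Fin k → Bool) (a b : Fin (k + 1)) : Bool :=
  if ha : a.val < k then (if hb : b.val < k then adj ⟨a.val, ha⟩ ⟨b.val, hb⟩ else s ⟨a.val, ha⟩)
  else (if hb : b.val < k then s ⟨b.val, hb⟩ else false)

/-- Old–old entries of the cone table. [folklore] -/
@[simp] theorem coneAdjB_castSucc_castSucc (adj : Fin k → Fin k → Bool) (s : Fin k → Bool) (i j : Fin k) :
    coneAdjB adj s i.castSucc j.castSucc = adj i j := by
  simp [coneAdjB]

/-- New–old entries of the cone table. [folklore] -/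
@[simp] theorem coneAdjB_last_castSucc (adj : Fin k → Fin k → Bool) (s : Fin k → Bool) (j : Fin k) :
    coneAdjB adj s (Fin.last k) j.castSucc = s j := by
  simp [coneAdjB]

/-- Old–new entries of the cone table. [folklore] -/
@[simp] theorem coneAdjB_castSucc_last (adj : Fin k → Fin k → Bool) (s : Fin k → Bool) (i : Fin k) :
    coneAdjB adj s i.castSucc (Fin.last k) = s i := by
  simp [coneAdjB]

/-- The new vertex has no loop. [folklore] -/
@[simp] theorem coneAdjB_last_last (adj : Fin k → Fin k → Bool) (s : Fin k → Bool) :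
    coneAdjB adj s (Fin.last k) (Fin.last k) = false := by
  simp [coneAdjB]

/-- The cone table is symmetric if `adj` is. [folklore] -/
theorem coneAdjB_symm (adj : Fin k → Fin k → Bool) (hs : ∀ a b, adj a b = adj b a) (s : Fin k → Bool) :
    ∀ a b, coneAdjB adj s a b = coneAdjB adj s b a := by
  intro a b
  induction a using Fin.lastCases <;> induction b using Fin.lastCases <;> simp [hs]

/-- The cone table is irreflexive if `adj` is. [folklore] -/
theorem coneAdjB_irrefl (adj : Fin k → Fin k → Bool) (hl : ∀ a, adj a a = false) (s : Fin k → Bool) :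
    ∀ a, coneAdjB adj s a a = false := by
  intro a
  induction a using Fin.lastCases <;> simp [hl]

/-- **The cone of a table graph is the table graph of the cone table.** [folklore] -/
theorem coneGraph_boolGraph (adj : Fin k → Fin k → Bool) (hs : ∀ a b, adj a b = adj b a) (hl : ∀ a, adj a a = false)
    (s : Fin k → Bool) :
    coneGraph (Fin.last k) (boolGraph adj hs hl) (Finset.univ.filter fun i => s i = true) =
      boolGraph (coneAdjB adj s) (coneAdjB_symm adj hs s) (coneAdjB_irrefl adj hl s) := by
  ext a b
  induction a using Fin.lastCases <;> induction b using Fin.lastCases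
  · simp only [SimpleGraph.irrefl]
  · rename_i j
    rw [boolGraph_adj, coneAdjB_last_castSucc, ← Fin.succAbove_last, coneGraph_adj_self_succAbove,
      Finset.mem_filter]
    simp
  · rename_i i
    rw [boolGraph_adj, coneAdjB_castSucc_last, ← Fin.succAbove_last, coneGraph_adj_succAbove_self,
      Finset.mem_filter]
    simp
  · rename_i i j
    rw [boolGraph_adj, coneAdjB_castSucc_castSucc, ← Fin.succAbove_last, coneGraph_adj_succAbove_succAbove,
      boolGraph_adj]

end Bool

/-! ### 3. Transport along a graph equality (instance-independent) -/

/-- Degrees agree along an equality of graphs, whatever the instances. [folklore] -/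
theorem degree_congr_of_eq {V : Type*} {G G' : SimpleGraph V} (h : G = G') (a : V) [Fintype (G.neighborSet a)]
    [Fintype (G'.neighborSet a)] : G.degree a = G'.degree a := by
  subst h
  exact congrArg (fun i => @SimpleGraph.degree V G a i) (Subsingleton.elim _ _)

/-- Edge counts agree along an equality of graphs, whatever the instances. [folklore] -/
theorem card_edgeFinset_congr_of_eq {V : Type*} {G G' : SimpleGraph V} (h : G = G') [Fintype G.edgeSet]
    [Fintype G'.edgeSet] : G.edgeFinset.card = G'.edgeFinset.card := by
  subst h
  exact congrArg (fun i => (@SimpleGraph.edgeFinset V G i).card) (Subsingleton.elim _ _)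

/-! ### 4. The degree-count lookup -/

/-- If all degrees of `G` are `≥ d > 0` and `w` is any vertex: the vertices of degree `d − 1` in `G − w` are exactly
(the preimages of) the degree-`d` neighbours of `w`. [folklore] -/
theorem card_filter_degree_comap_succAbove {m d : ℕ} (G : SimpleGraph (Fin (m + 1))) [DecidableRel G.Adj]
    (w : Fin (m + 1)) (hmin : ∀ v, d ≤ G.degree v) (hd : 0 < d) :
    (Finset.univ.filter fun j => (G.comap w.succAbove).degree j = d - 1).card =
      (Finset.univ.filter fun v => G.Adj w v ∧ G.degree v = d).card := by
  rw [← Finset.card_map w.succAboveEmb]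
  congr 1
  ext v
  simp only [Finset.mem_map, Finset.mem_filter, Finset.mem_univ, true_and, Fin.coe_succAboveEmb]
  constructor
  · rintro ⟨j, hj, rfl⟩
    have h := degree_comap_succAbove_add G w j
    have h2 := hmin (w.succAbove j)
    by_cases hadj : G.Adj w (w.succAbove j)
    · rw [if_pos hadj] at h
      exact ⟨hadj, by omega⟩
    · rw [if_neg hadj] at h
      omega
  · rintro ⟨hadj, hdeg⟩
    obtain ⟨j, rfl⟩ := Fin.exists_succAbove_eq (G.ne_of_adj hadj).symm
    refine ⟨j, ?_, rfl⟩
    have h := degree_comap_succAbove_add G w j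
    rw [if_pos hadj] at h
    omega

/-- The number of vertices of a given degree is an isomorphism invariant. [folklore] -/
theorem card_filter_degree_eq_of_iso {V W : Type*} [Fintype V] [Fintype W] {G : SimpleGraph V}
    {H : SimpleGraph W} [DecidableRel G.Adj] [DecidableRel H.Adj] (φ : G ≃g H) (t : ℕ) :
    (Finset.univ.filter fun v => G.degree v = t).card = (Finset.univ.filter fun w => H.degree w = t).card := by
  classical
  rw [← Finset.card_map φ.toEquiv.toEmbedding]
  congr 1
  ext w
  simp only [Finset.mem_map, Finset.mem_filter, Finset.mem_univ, true_and, Equiv.coe_toEmbedding,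
    RelIso.coe_fn_toEquiv]
  constructor
  · rintro ⟨v, hv, rfl⟩
    rwa [φ.degree_eq]
  · intro hw
    refine ⟨φ.symm w, ?_, RelIso.apply_symm_apply φ w⟩
    have h := φ.degree_eq (φ.symm w)
    rw [RelIso.apply_symm_apply] at h
    rw [h] at hw
    exact hw

/-- **Degree-count lookup.** If all degrees of `G` are `≥ d > 0`, `w` is a vertex, and `G − w ≅ H`, then the number of
degree-`d` neighbours of `w` in `G` equals the number of degree-`(d − 1)` vertices of `H`. [folklore] -/
theorem card_adjDegree_eq_of_iso {m d : ℕ} (G : SimpleGraph (Fin (m + 1))) [DecidableRel G.Adj]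
    {H : SimpleGraph (Fin m)} [DecidableRel H.Adj] (w : Fin (m + 1)) (hmin : ∀ v, d ≤ G.degree v) (hd : 0 < d)
    (φ : G.comap w.succAbove ≃g H) :
    (Finset.univ.filter fun v => G.Adj w v ∧ G.degree v = d).card =
      (Finset.univ.filter fun j => H.degree j = d - 1).card := by
  rw [← card_filter_degree_comap_succAbove G w hmin hd]
  exact card_filter_degree_eq_of_iso φ (d - 1)

/-! ### 5. Subsets as bitmasks -/

/-- Bits of `∑_{i ∈ S} 2^{i}` (`S ⊆ Fin k`) are membership in `S`. [folklore] -/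
theorem testBit_sum_two_pow_val {k : ℕ} (S : Finset (Fin k)) (i : Fin k) :
    (∑ j ∈ S, 2 ^ (j : ℕ)).testBit i = decide (i ∈ S) := by
  have hsum : ∑ j ∈ S, 2 ^ (j : ℕ) = ∑ t ∈ S.map Fin.valEmbedding, 2 ^ t := by
    rw [Finset.sum_map]
    rfl
  have key : ∀ t : ℕ, (∑ j ∈ S, 2 ^ (j : ℕ)).testBit t = true ↔ t ∈ S.map Fin.valEmbedding := by
    intro t
    rw [hsum, ← Nat.mem_bitIndices, ← List.mem_toFinset, Finset.toFinset_bitIndices_sum_two_pow]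
  by_cases hi : i ∈ S
  · rw [decide_eq_true hi]
    exact (key i).2 (Finset.mem_map.2 ⟨i, hi, rfl⟩)
  · rw [decide_eq_false hi]
    by_contra h
    rw [Bool.not_eq_false] at h
    obtain ⟨j, hj, hji⟩ := Finset.mem_map.1 ((key i).1 h)
    exact hi (by rwa [← Fin.ext hji])

/-- The bitmask of `S ⊆ Fin k` lies in `List.range (2^k)` (the range the kernel certificates iterate over).
[folklore] -/
theorem sum_two_pow_val_mem_range {k : ℕ} (S : Finset (Fin k)) : ∑ j ∈ S, 2 ^ (j : ℕ) ∈ List.range (2 ^ k) := by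
  rw [List.mem_range]
  have hsum : ∑ j ∈ S, 2 ^ (j : ℕ) = ∑ t ∈ S.map Fin.valEmbedding, 2 ^ t := by
    rw [Finset.sum_map]
    rfl
  rw [hsum]
  exact Nat.geomSum_lt le_rfl fun t ht => by
    obtain ⟨j, -, rfl⟩ := Finset.mem_map.1 ht
    exact j.isLt

/-- The indicator of `S` recovered from its bitmask. [folklore] -/
def maskFun {k : ℕ} (c : ℕ) (i : Fin k) : Bool := c.testBit i.val

/-- `maskFun (∑_{i∈S} 2^i) = (· ∈ S)`. [folklore] -/
theorem maskFun_sum_two_pow {k : ℕ} (S : Finset (Fin k)) :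
    maskFun (∑ j ∈ S, 2 ^ (j : ℕ)) = fun i : Fin k => decide (i ∈ S) := by
  funext i
  exact testBit_sum_two_pow_val S i

/-- Every `S ⊆ Fin k` is the filter of its indicator. [folklore] -/
theorem eq_filter_decide_mem {k : ℕ} (S : Finset (Fin k)) :
    S = Finset.univ.filter fun i => decide (i ∈ S) = true := by
  ext i
  simp

/-- `|S|` as a count of its indicator. [folklore] -/
theorem card_eq_countP_decide_mem {k : ℕ} (S : Finset (Fin k)) :
    S.card = (List.finRange k).countP fun i => decide (i ∈ S) := by
  conv_lhs => rw [eq_filter_decide_mem S]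
  rw [card_filter_univ_eq_countP]
  simp only [Bool.decide_eq_true]

end Summit.Ventures.Crystal3D
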